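import Summits.AtomisticToContinuum.BoseEinsteinCondensation.Theorems.LatticeODLROOffHalfFilling.Negative.OffHalfFillingForced

/-!
# Route `BECGroundStateSOS`, crux `LatticeODLROOffHalfFilling` (stmt-AtomisticToContinuum-11033),
# line `Sketch`: the registered stub `stub_anchor`

Supports (does not close) stmt-AtomisticToContinuum-11033. The Kennedy–Lieb–Shastry anchor in
column form: the in-tree KLS theorem (`lroAt_zero`, the `μ = 0` slice of the crux) says the
normalised planar order parameter `f k = Re ω_{2k,0}(O)/((2k)³)²`, `O = Σ_{x,y} hop x y`
(`orderParam_eq_re_gsf`), has `0 < liminf f`; with `a₀ := liminf f / 2` one gets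
`a₀ ((2k)³)² ≤ Re ω_{2k,0}(O)` for all large `k` (`Filter.eventually_lt_of_lt_liminf`, the terms
being `≥ 0` by `orderParam_nonneg`), and the pigeonhole `exists_col_quad_ge` on the tracial ground
state `ω_{2k,0} = tr(P₀ ·)/tr P₀` produces a nonzero column `ψ = P₀ e_σ` of the ground projection
of `H_{2k,0}` with `a₀ ((2k)³)² ‖ψ‖² ≤ Re⟨ψ, O ψ⟩`. This is literally the first half of
`offHalfFilling_forced` (Negative/OffHalfFillingForced.lean).
-/

noncomputable section

namespace Summit.AtomisticToContinuum.BoseEinsteinCondensation.Theorems.LatticeODLROOffHalfFilling.Ladder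

open Literature.MathematicalPhysics.QuantumLattice Literature.Probability.LatticeModels Matrix Finset
open Summit.AtomisticToContinuum.BoseEinsteinCondensation.Theorems.LatticeODLROOffHalfFilling.Negative
open scoped ComplexOrder BigOperators

/-- **The KLS anchor, column form.** From the in-tree Kennedy–Lieb–Shastry theorem
(`lroAt_zero`, `orderParam_eq_re_gsf`) and the pigeonhole `exists_col_quad_ge`: there is `a₀ > 0`
such that for all large `k` some nonzero column of `P₀(H_{2k,0})` has planar moment
`≥ a₀ (2k)⁶ ‖·‖²`. [cite: KLS1988PRL, Theorem] -/
theorem stub_anchor :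
    ∃ a₀ : ℝ, 0 < a₀ ∧ ∃ k₀ : ℕ, ∀ k : ℕ, k₀ ≤ k → ∀ [NeZero (2 * k)],
      ∃ σ, (Hmu (2 * k) 0).groundProj.col σ ≠ 0 ∧
        a₀ * (((2 * k : ℕ) : ℝ) ^ 3) ^ 2 *
            (star ((Hmu (2 * k) 0).groundProj.col σ) ⬝ᵥ (Hmu (2 * k) 0).groundProj.col σ).re ≤
          (star ((Hmu (2 * k) 0).groundProj.col σ) ⬝ᵥ
            (∑ x : TorusSite 3 (2 * k), ∑ y : TorusSite 3 (2 * k), hop x y) *ᵥ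
              ((Hmu (2 * k) 0).groundProj.col σ)).re := by
  -- the KLS theorem, quantitatively: `0 < liminf f`, `0 ≤ f k`, `f k = Re ω_{2k,0}(O)/((2k)³)²`
  obtain ⟨f, hfpos, hf0, hfk⟩ : ∃ f : ℕ → ℝ, 0 < Filter.liminf f Filter.atTop ∧ (∀ k, 0 ≤ f k) ∧
      ∀ k : ℕ, 2 ≤ k → ∀ [NeZero (2 * k)], f k = ((Hmu (2 * k) 0).groundStateFunctional
        (∑ s : TorusSite 3 (2 * k), ∑ t : TorusSite 3 (2 * k), hop s t)).re /
        (((2 * k : ℕ) : ℝ) ^ 3) ^ 2 := by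
    have h := lroAt_zero
    unfold LROAt at h
    exact ⟨_, h, fun k => orderParam_nonneg 0 k, fun k hk _ => orderParam_eq_re_gsf 0 hk⟩
  set a₀ : ℝ := Filter.liminf f Filter.atTop / 2 with ha₀
  have ha₀pos : 0 < a₀ := by positivity
  have hev : ∀ᶠ k : ℕ in Filter.atTop, a₀ < f k :=
    Filter.eventually_lt_of_lt_liminf (by linarith : a₀ < Filter.liminf f Filter.atTop)
      ⟨0, Filter.eventually_map.mpr (Filter.Eventually.of_forall fun k => hf0 k)⟩
  obtain ⟨k₀, hk₀⟩ := Filter.eventually_atTop.mp (hev.and (Filter.eventually_ge_atTop 2))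
  refine ⟨a₀, ha₀pos, k₀, fun k hk _ => ?_⟩
  obtain ⟨h1, h2⟩ := hk₀ k hk
  rw [hfk k h2] at h1
  have hX : (0 : ℝ) < (((2 * k : ℕ) : ℝ) ^ 3) ^ 2 := by positivity
  have hLRO : a₀ * (((2 * k : ℕ) : ℝ) ^ 3) ^ 2 ≤
      ((Hmu (2 * k) 0).groundStateFunctional
        (∑ s : TorusSite 3 (2 * k), ∑ t : TorusSite 3 (2 * k), hop s t)).re := by
    rw [lt_div_iff₀ hX] at h1
    exact h1.le
  exact exists_col_quad_ge (Hmu_isHermitian (2 * k) 0) _ _ hLRO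

end Summit.AtomisticToContinuum.BoseEinsteinCondensation.Theorems.LatticeODLROOffHalfFilling.Ladder
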